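import Summits.QuantumFields.BalabanUV.T4Continuum.Support.NE7EtaSupFromEnergyTorus
import Literature.MathematicalPhysics.QuantumFieldTheory.Balaban1983to89.B4Block227

/-!
# NE7EtaGradientFromEnergy — route #1 of the NE7 crux, hardest stub S1∕L7b: the GRADIENT coordinate of the U-slot currency —
# a discrete Landau–Kolmogorov step «sup small + second differences bounded ⇒ first differences small», applied to the two-run
# discrepancy direction `Z` on top of `NE7EtaSupFromEnergyTorus.norm_dir_le_opt_d4`

Cell `pub-balaban`, rung (B)+1 sub-cell t4, lineage `b2b-balaban-t4-ne7-p1`, generation 21 (CRUX PROVER NE7 #1, ruling e34b3e0c); crux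
skeleton `t4/skeletons/NE7-CRUX-R1.md` v1.5.1 §3bis (currency census, REVISED against the print).  HONEST FRAMING (page 1): FIXED FINITE
T⁴, rung (B)+1; NE7, NE3 NOT PRINTED in [Balaban1984PropagatorsI]–[Balaban1989LargeFieldII] and NOT PROVED here; continuum YM on T⁴ ⇐
BetaPertH ∧ nine spine estimates (0/9 proved); BetaPertH ⇐ (D1) ∧ (D4) ∧ CAP+tail; G-an2-4 gates asym, D1 and NE2/3/4; NOT infinite
volume, NOT mass gap, NOT Clay.

WHY (the print, [Balaban1987RG1] p. 262, read this generation from the held text `paper:balaban1987-cmp109-rg-i-small-field` p. 14):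
the analyticity spaces `U^c_j(X, α₀, α₁, γ₀)` are unions of orbits of pairs `(U, J)` with (i) `U = U′Ũ`, `Ũ` G-valued,
`|∂Ũ − 1| < α₀ξ²` (1.11) and locally `Ũ^u = exp iξA`, `|A|, |∇^ξA| < O(1)LMBα₀` (1.12); (ii) `U′ = exp iξA′`, `A′` complex,
`|A′|, |∇^ξ_Ũ A′| < α₁` (1.13); (iii) `|∂U − 1| < α₀ξ²`, `|J| < γ₀` (1.14); (iv) (1.15)–(1.16) on the minimal configurations of the
averages.  So the COMPLEX DIRECTIONS of the Cauchy step are potentials `A′` measured in FIELD units TOGETHER WITH THEIR LATTICE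
GRADIENT `∇^ξ`, radius `α₁` ((2.28) of [Balaban1988Convergent]: `α_{1,j} = g_jC₁(log g_j^{−2})^{q₁}`).  Comparing the two runs'
backgrounds `W` and `W e^Z` (`Z = iξa`) through an analytic `E^{(j)}` therefore costs `max(‖a‖_∞, ‖∇^ξ a‖_∞)∕α₁` — BOTH the sup of the
discrepancy potential `a = Z∕ξ` AND the sup of its lattice gradient `∇^ξ a = (∇Z)∕ξ²` must tend to zero.  `NE7EtaSupFromEnergyTorus`
gives `‖Z‖_∞ ≤ 2a²b ≍ ξ^{4/3}` (so `‖a‖_∞ ≍ ξ^{1/3}`) from the energy conjunct + (Lip₁).  The energy norm does NOT control the full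
gradient of `Z` (only its dressed curl), so for `∇Z` this file interpolates ONCE MORE, between the sup of `Z` and a bound `λ₂` on the
SECOND differences of `Z` along lattice directions ((Lip₂′): `λ₂ = Λ₂′ξ³`, field-unit second derivatives of `a` bounded — regular-gauge
TYPE, cf. (1.12)–(1.13) and «(3.35)–(3.38) [13]»):
 * §1 (generic, any seminormed group, on `ℤ^d`): `telescope_fwd` (+ the tree's `B4Block227.sum_range_id_real`), **`norm_fwdDiff_le_of_sup_of_second`**
   (`‖f(x + e_μ) − f x‖ ≤ 2M∕m + λ₂(m − 1)∕2` for every `m ≥ 1`, `M = sup‖f‖`, `λ₂ = sup` of second differences along `μ`) and the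
   optimised **`norm_fwdDiff_le_two_sqrt`** (`≤ 2√(M·λ₂)`, choosing `m = ⌈2√(M∕λ₂)⌉` or `1`);
 * §2 (d = 4, the cell's data): **`norm_dirDiff_le_of_energy_d4`** — `P`-periodic `W`, `Z`; (Lip₁) with `8λ ≤ a³`, `L^k·E ≤ b³`,
   `b∕a + 1 ≤ P` (so `‖Z‖_∞ ≤ 2a²b` by `norm_dir_le_opt_d4`) and (Lip₂′) second differences `≤ λ₂` ⇒
   `‖Z (x + e_μ) κ − Z x κ‖ ≤ 2√(2a²b·λ₂)` for all `x, μ, κ`.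
EXPONENT COUNT (prose): `2a²b ≍ ξ^{4/3}`, `λ₂ = Λ₂′ξ³` ⇒ `‖∇Z‖_∞ ≲ ξ^{13/6}`, i.e. `‖∇^ξ a‖_∞ ≲ ξ^{1/6}`: the gradient coordinate of the
U-slot closeness decays at GEOMETRIC rate `L^{−1/6}` per step (the potential coordinate at `L^{−1/3}`, the plaquette coordinate (1.14) at
`L^{−1/3}` by `NE7EtaPlaquetteClosenessTorus`) — all tolerated by `T4TowerRateDischarge` §3 (any common rate `< 1`).
HONEST.  Elementary ([folklore]); (Lip₁), (Lip₂′), T-E_w are HYPOTHESES (row NE3's; re-typed INTERFACE REQUEST NE7→NE3 of skeleton v1.5.1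
§4); the gauge in which `Z` is read is the root's `u` (NE3's choice inside its ∃); NODE O's carrier untouched; nothing of NE3∕NE7
discharged; 0 def; 0 sorry; nothing printed is a hypothesis of a theorem.
-/

set_option autoImplicit false

open scoped BigOperators Matrix Matrix.Norms.L2Operator
open Finset

namespace Summit.QuantumFields.BalabanUV.T4Continuum.NE7EtaGradientFromEnergy

open Literature.MathematicalPhysics.QuantumFieldTheory.Balaban1983to89
open B7Prop1Explicit B7Prop2Explicit
open T4AveragingDeficitWall hiding Site Plane Plaq Bond
open T4AveragingDeficitWallBoundary (periodBox IsPeriodicCfg)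
open AveragingDeficitPeriodicCounting (IsPeriodicDir)
open NE3EnergyWeightedShapes (energyNormW energyNormW_nonneg)
open NE7EtaSupFromEnergyTorus (norm_dir_le_opt_d4)

noncomputable section

/-! ## §1 Discrete Landau–Kolmogorov along a lattice direction -/

section LK

variable {d : ℕ} {E : Type*} [NormedAddCommGroup E] [NormedSpace ℝ E]

omit [NormedSpace ℝ E] in
/-- TELESCOPE: `f (x + m•e_μ) − f x = Σ_{j<m} (f (x + (j+1)•e_μ) − f (x + j•e_μ))`. [folklore] -/
theorem telescope_fwd (f : Site d → E) (x : Site d) (μ : Fin d) (m : ℕ) :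
    f (x + m • e μ) - f x = ∑ j ∈ Finset.range m, (f (x + (j + 1) • e μ) - f (x + j • e μ)) := by
  induction m with
  | zero => simp
  | succ m ih =>
    rw [Finset.sum_range_succ, ← ih]
    abel

omit [NormedSpace ℝ E] in
/-- THE FIRST DIFFERENCE `j` STEPS AHEAD differs from the one at `x` by at most `j·λ₂` (`λ₂` bounds the second differences along `μ`).
[folklore] -/
theorem norm_fwdDiff_shift_sub_le (f : Site d → E) (μ : Fin d) {lam2 : ℝ}
    (h2 : ∀ y : Site d, ‖(f (y + (2 : ℕ) • e μ) - f (y + e μ)) - (f (y + e μ) - f y)‖ ≤ lam2) (x : Site d) :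
    ∀ j : ℕ, ‖(f (x + (j + 1) • e μ) - f (x + j • e μ)) - (f (x + e μ) - f x)‖ ≤ j * lam2
  | 0 => by simp
  | j + 1 => by
    have ih := norm_fwdDiff_shift_sub_le f μ h2 x j
    have hstep := h2 (x + j • e μ)
    have e1 : x + j • e μ + (2 : ℕ) • e μ = x + (j + 1 + 1) • e μ := by rw [add_assoc, ← add_nsmul]
    have e2 : x + j • e μ + e μ = x + (j + 1) • e μ := by rw [add_assoc, succ_nsmul]
    rw [e1, e2] at hstep
    calc ‖(f (x + (j + 1 + 1) • e μ) - f (x + (j + 1) • e μ)) - (f (x + e μ) - f x)‖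
        = ‖((f (x + (j + 1 + 1) • e μ) - f (x + (j + 1) • e μ)) - (f (x + (j + 1) • e μ) - f (x + j • e μ)))
            + ((f (x + (j + 1) • e μ) - f (x + j • e μ)) - (f (x + e μ) - f x))‖ := by congr 1; abel
      _ ≤ lam2 + j * lam2 := (norm_add_le _ _).trans (add_le_add hstep ih)
      _ = (j + 1 : ℕ) * lam2 := by push_cast; ring

/-- **DISCRETE LANDAU–KOLMOGOROV (two-term form)**: if `‖f‖ ≤ M` everywhere and the second differences along `μ` are `≤ λ₂`, then for
every `m ≥ 1`: `‖f (x + e_μ) − f x‖ ≤ 2M∕m + λ₂·(m − 1)∕2`. [folklore] -/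
theorem norm_fwdDiff_le_of_sup_of_second (f : Site d → E) (μ : Fin d) {M lam2 : ℝ} (hM : ∀ y, ‖f y‖ ≤ M)
    (h2 : ∀ y : Site d, ‖(f (y + (2 : ℕ) • e μ) - f (y + e μ)) - (f (y + e μ) - f y)‖ ≤ lam2) (x : Site d) {m : ℕ}
    (hm : 1 ≤ m) : ‖f (x + e μ) - f x‖ ≤ 2 * M / m + lam2 * ((m : ℝ) - 1) / 2 := by
  -- m·D(x) = (f(x+m) − f(x)) − Σ_{j<m} (D(x+j) − D(x))
  set D : Site d → E := fun y => f (y + e μ) - f y with hD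
  have hsum : ∑ j ∈ Finset.range m, (f (x + (j + 1) • e μ) - f (x + j • e μ))
      = m • D x + ∑ j ∈ Finset.range m, ((f (x + (j + 1) • e μ) - f (x + j • e μ)) - D x) := by
    simp only [Finset.sum_sub_distrib, Finset.sum_const, Finset.card_range]; abel
  have hkey : (m : ℕ) • D x = (f (x + m • e μ) - f x)
      - ∑ j ∈ Finset.range m, ((f (x + (j + 1) • e μ) - f (x + j • e μ)) - D x) := by
    rw [telescope_fwd, hsum]; abel
  have hn1 : ‖f (x + m • e μ) - f x‖ ≤ 2 * M := by
    calc ‖f (x + m • e μ) - f x‖ ≤ ‖f (x + m • e μ)‖ + ‖f x‖ := norm_sub_le _ _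
      _ ≤ M + M := add_le_add (hM _) (hM _)
      _ = 2 * M := by ring
  have hn2 : ‖∑ j ∈ Finset.range m, ((f (x + (j + 1) • e μ) - f (x + j • e μ)) - D x)‖ ≤ lam2 * ((m : ℝ) * ((m : ℝ) - 1) / 2) := by
    calc ‖∑ j ∈ Finset.range m, ((f (x + (j + 1) • e μ) - f (x + j • e μ)) - D x)‖
        ≤ ∑ j ∈ Finset.range m, ‖(f (x + (j + 1) • e μ) - f (x + j • e μ)) - D x‖ := norm_sum_le _ _
      _ ≤ ∑ j ∈ Finset.range m, (j : ℝ) * lam2 := Finset.sum_le_sum fun j _ => norm_fwdDiff_shift_sub_le f μ h2 x j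
      _ = lam2 * ∑ j ∈ Finset.range m, (j : ℝ) := by rw [Finset.mul_sum]; exact Finset.sum_congr rfl fun j _ => by ring
      _ = lam2 * ((m : ℝ) * ((m : ℝ) - 1) / 2) := by rw [B4Block227.sum_range_id_real]
  have hmpos : (0 : ℝ) < m := by exact_mod_cast hm
  have hnorm : (m : ℝ) * ‖D x‖ ≤ 2 * M + lam2 * ((m : ℝ) * ((m : ℝ) - 1) / 2) := by
    have : ‖(m : ℕ) • D x‖ = (m : ℝ) * ‖D x‖ := by
      rw [← Nat.cast_smul_eq_nsmul ℝ, norm_smul, Real.norm_natCast]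
    rw [← this, hkey]
    exact (norm_sub_le _ _).trans (add_le_add hn1 hn2)
  -- divide by m
  have : ‖D x‖ ≤ (2 * M + lam2 * ((m : ℝ) * ((m : ℝ) - 1) / 2)) / m := by
    rw [le_div_iff₀ hmpos]; linarith
  calc ‖f (x + e μ) - f x‖ = ‖D x‖ := rfl
    _ ≤ (2 * M + lam2 * ((m : ℝ) * ((m : ℝ) - 1) / 2)) / m := this
    _ = 2 * M / m + lam2 * ((m : ℝ) - 1) / 2 := by field_simp

/-- **DISCRETE LANDAU–KOLMOGOROV, OPTIMISED**: `‖f‖ ≤ M`, second differences along `μ` `≤ λ₂`, `M, λ₂ > 0` ⇒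
`‖f (x + e_μ) − f x‖ ≤ 2·√(M·λ₂)` (take `m = ⌈2√(M∕λ₂)⌉` if that is `≥ 1`, else `m = 1`). [folklore] -/
theorem norm_fwdDiff_le_two_sqrt (f : Site d → E) (μ : Fin d) {M lam2 : ℝ} (hM0 : 0 < M) (hl0 : 0 < lam2)
    (hM : ∀ y, ‖f y‖ ≤ M) (h2 : ∀ y : Site d, ‖(f (y + (2 : ℕ) • e μ) - f (y + e μ)) - (f (y + e μ) - f y)‖ ≤ lam2)
    (x : Site d) : ‖f (x + e μ) - f x‖ ≤ 2 * Real.sqrt (M * lam2) := by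
  set θ : ℝ := 2 * Real.sqrt (M / lam2) with hθ
  have hs : Real.sqrt (M * lam2) = Real.sqrt (M / lam2) * lam2 := by
    rw [show M * lam2 = (M / lam2) * lam2 ^ 2 by field_simp, Real.sqrt_mul (div_pos hM0 hl0).le,
      Real.sqrt_sq hl0.le]
  have hs' : M = Real.sqrt (M / lam2) * Real.sqrt (M / lam2) * lam2 := by
    rw [← Real.sqrt_mul (div_pos hM0 hl0).le, Real.sqrt_mul_self (div_pos hM0 hl0).le]; field_simp
  have hq0 : 0 < Real.sqrt (M / lam2) := Real.sqrt_pos.mpr (div_pos hM0 hl0)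
  by_cases hθ1 : 1 ≤ θ
  · -- m = ⌈θ⌉ ≥ 1
    set m : ℕ := ⌈θ⌉₊ with hm
    have hm1 : 1 ≤ m := Nat.one_le_iff_ne_zero.mpr (Nat.pos_iff_ne_zero.mp (Nat.ceil_pos.mpr (by linarith)))
    have hmge : θ ≤ (m : ℝ) := Nat.le_ceil θ
    have hmlt : (m : ℝ) < θ + 1 := Nat.ceil_lt_add_one (by linarith)
    have h := norm_fwdDiff_le_of_sup_of_second f μ hM h2 x hm1
    have hmpos : (0 : ℝ) < m := by exact_mod_cast hm1
    -- 2M/m ≤ 2M/θ = √(Mλ₂)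
    have h1 : 2 * M / m ≤ Real.sqrt (M * lam2) := by
      rw [div_le_iff₀ hmpos, hs]
      have : 2 * M = Real.sqrt (M / lam2) * lam2 * θ := by rw [hθ]; nth_rewrite 1 [hs']; ring
      rw [this]
      exact mul_le_mul_of_nonneg_left hmge (by positivity)
    -- λ₂(m−1)/2 ≤ λ₂θ/2 = √(Mλ₂)
    have h2' : lam2 * ((m : ℝ) - 1) / 2 ≤ Real.sqrt (M * lam2) := by
      rw [hs]
      have : lam2 * ((m : ℝ) - 1) ≤ lam2 * θ := mul_le_mul_of_nonneg_left (by linarith) hl0.le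
      rw [hθ] at this
      linarith
    linarith
  · -- θ < 1, i.e. 4M < λ₂: take m = 1
    push Not at hθ1
    have h := norm_fwdDiff_le_of_sup_of_second f μ hM h2 x (le_refl 1)
    simp only [Nat.cast_one, div_one, sub_self, mul_zero, zero_div, add_zero] at h
    -- 2M = θ·√(M/λ₂)·λ₂ ... : 2M = θ · √(Mλ₂) < √(Mλ₂) ≤ 2√(Mλ₂)
    have e2 : 2 * M = θ * Real.sqrt (M * lam2) := by rw [hθ, hs]; nth_rewrite 1 [hs']; ring
    have hpos : 0 ≤ Real.sqrt (M * lam2) := Real.sqrt_nonneg _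
    have : 2 * M ≤ 2 * Real.sqrt (M * lam2) := by rw [e2]; nlinarith
    linarith

end LK

/-! ## §2 The gradient of the discrepancy direction at `d = 4` -/

section Gradient

variable {n : Type*} [Fintype n] [DecidableEq n]

/-- **THE GRADIENT COORDINATE**: `P`-periodic `W`, `Z` on `ℤ⁴`; (Lip₁) with `8λ ≤ a³`-data as in `norm_dir_le_opt_d4` (there `a³ = 8λ`,
`b³ = L^k·E`, `b∕a + 1 ≤ P`, giving `‖Z‖_∞ ≤ 2a²b`), and (Lip₂′) second differences of `Z(·, κ)` along every direction `≤ λ₂` (`λ₂ > 0`)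
⇒ `‖Z (x + e_μ) κ − Z x κ‖ ≤ 2√(2a²b·λ₂)` for all `x, μ`.  Reading: `2a²b ≍ ξ^{4/3}`, `λ₂ = Λ₂′ξ³` ⇒ `‖∇Z‖_∞ ≲ ξ^{13/6}`,
`‖∇^ξ a‖_∞ ≲ ξ^{1/6}`. [folklore] -/
theorem norm_dirDiff_le_of_energy_d4 {L : ℕ} (hL : 1 ≤ L) (k : ℕ) {P : ℕ} (hP : 1 ≤ P)
    {W : Site 4 → Fin 4 → (Matrix n n ℂ)ˣ} {Z : Site 4 → Fin 4 → Matrix n n ℂ} (hW : IsPeriodicCfg W (P : ℤ))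
    (hZ : IsPeriodicDir Z (P : ℤ)) (κ : Fin 4) {lam : ℝ}
    (hlip : ∀ (x : Site 4) (μ : Fin 4), ‖Z (x + e μ) κ - Z x κ‖ ≤ lam)
    {a b : ℝ} (ha : 0 < a) (hb : 0 < b) (ha3 : a ^ 3 = 8 * lam)
    (hb3 : b ^ 3 = (L : ℝ) ^ k * energyNormW L k W Z (periodBox (d := 4) P)) (hfit : b / a + 1 ≤ P)
    {lam2 : ℝ} (hl2 : 0 < lam2)
    (h2 : ∀ (μ : Fin 4) (y : Site 4), ‖(Z (y + (2 : ℕ) • e μ) κ - Z (y + e μ) κ) - (Z (y + e μ) κ - Z y κ)‖ ≤ lam2)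
    (x : Site 4) (μ : Fin 4) :
    ‖Z (x + e μ) κ - Z x κ‖ ≤ 2 * Real.sqrt (2 * a ^ 2 * b * lam2) := by
  have hsup : ∀ y, ‖Z y κ‖ ≤ 2 * a ^ 2 * b := fun y => norm_dir_le_opt_d4 hL k hP hW hZ κ hlip ha hb ha3 hb3 hfit y
  have hM0 : 0 < 2 * a ^ 2 * b := by positivity
  exact norm_fwdDiff_le_two_sqrt (fun y => Z y κ) μ hM0 hl2 hsup (h2 μ) x

end Gradient

end

end Summit.QuantumFields.BalabanUV.T4Continuum.NE7EtaGradientFromEnergy
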